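import Summits.QuantumFields.BalabanUV.Beta.MultiscaleSupMemberBall

/-!
# `Summit.QuantumFields.BalabanUV.Beta.MultiscaleAveragingPointwise` — engine file 10a: the POINTWISE averaging budget for the
# multi-region averaged MODEL operator: `|((Σ_l a_lG_lᵀG_l) f)(x,i)| ≤ a_max·(S_{l_k}²)⁻¹·√((S_{l_k}^d)⁻¹·Σ_{cell k × Cp} f²)` for `x`
# in cell `k` — the averaging part of `levelOp` maps ℓ²(cell) → ℓ^∞ with the gain `a_max·n^{−2}·√(n^{−d})` (input of file 10b
# `MultiscaleLaplacianMember`, the Laplacian member (3.42)₄'s SHAPE without a regularity datum)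

HONEST FRAMING (page 1 of everything in this cell).  Discharging `FlowStep.BetaPertH` would make Bałaban's ultraviolet
stability UNCONDITIONAL — a constructive-QFT result; it is NOT the continuum limit and NOT the Clay problem.  This module
discharges nothing of `BetaPertH`; it is [folklore] finite-dimensional bookkeeping, kernel-checked, by the OWNER of binder row D4
(unit `b2b-balaban-beta-an4`, gen 44).  HONEST DEPENDENCY: continuum YM on T⁴ ⇐ BetaPertH ∧ nine spine estimates (0/9 proved);
BetaPertH ⇐ (D1) ∧ (D4) ∧ CAP+tail; G-an2-4 gates asym, D1 and NE2/3/4.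

WHAT IS CERTIFIED (kernel, 0 sorry), in the MODEL setting of `MultiscaleDecay.hc_levelOp`'s averaging data (a pairwise-disjoint
COVERING cube family on the torus `UT N` — cell `k`: level `l_k`, side `S_{l_k}`, block corner `ctrU (zc k)` —, block weights
`W_l(x) = ω_l(corner_l x)` supported on the level-`l` cells (`hsupp`), isometric level transports `T` (`TᵀT = 1`), coefficients
`a ≥ 0`, print size `a_lω_l²S_l^d ≤ a_max/S_l²` (`hscale`)):
* `isometry_sq_sum` (`Σ_{i′}(Σ_j T_{i′j}v_j)² = Σ_j v_j²`), `abs_sum_col_mul_le` (Cauchy–Schwarz against a unit column),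
  `sq_sum_le_card_mul` (`(Σ_F h)² ≤ #F·Σ_F h²`);
* `block_filter_eq_cell` (the level-`l_k` block of corner `ctrU (zc k)` IS cell `k`, as site sets), `sum_cellCp_eq` (product
  decomposition of the cell × component sum);
* **`abs_levelSum_apply_le`** — THE POINTWISE AVERAGING BUDGET: for every field `f` and `p = (x,i)` with `x` in cell `k`,
  `|((Σ_l a_lG_lᵀG_l) f)(p)| ≤ a_max·(S_{l_k}²)⁻¹·√((S_{l_k}^d)⁻¹·Σ_{q ∈ cell k × Cp} f(q)²)` — only the level `l_k` acts at `x` (by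
  `hsupp` and disjointness), the transported cell mean costs `√#cell·‖f‖_{ℓ²(cell)}` (Cauchy–Schwarz twice, `card_block_le`) and
  carries the weight `aω² ≤ a_maxS^{−d−2}`.  MODEL form of «(Q′*aQ′λ)(x) = a_j(L^jη)^{−2}(Q′_jλ)(y), x ∈ B^j(y)» read off the
  quadratic form (3.24).
Constants: `a_max` only.  Ingredients BY NAME: pv21 `B9Thm37GlueTorusCovLevels.levelSum_apply`, `B9Thm37GlueTorusCovComp.
gMean_apply`∕`gMeanT_apply`, beta-d4-p2 `MultiscaleDecayBudget.card_block_le`∕`cellOf_spec`∕`cellOf_cellPt`,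
`MultiscaleCoerciveTorus.tblk_eq_iff`∕`tblk_cubePt`∕`ctrU_injective`.

LOCATORS (shape only, nothing printed asserted; ABSOLUTE RULE): [Balaban1985BackgroundPropagators] (3.16) p. 393, (3.19) p. 393,
(3.24) p. 394.  Row D4: NO class change (critical-path width 0; D4 DISCHARGE NO DATE); NOT BetaPertH, NOT continuum, NOT Clay,
NOT summit progress.
-/

open scoped BigOperators
open Finset

namespace Summit.QuantumFields.BalabanUV.Beta.MultiscaleAveragingPointwise

open Summit.QuantumFields.BalabanUV.Beta.MultiscaleCombesThomasL2CellsGraded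
  (siteScale_ctrU real_cellNorm_levelOp_inverse_le_graded)
open Summit.QuantumFields.BalabanUV.Beta.MultiscaleSupMemberBall (cell_norm_le_of_abs_le scale_pow_le card_cellCp_le)
open Summit.QuantumFields.BalabanUV.Beta.BoxPoincare (Box)
open Summit.QuantumFields.BalabanUV.Beta.MultiscaleCoerciveTorus
open Summit.QuantumFields.BalabanUV.Beta.MultiscaleDistance
open Summit.QuantumFields.BalabanUV.Beta.MultiscaleDistanceGraded (scale_le_scale_mul_exp_add)
open Summit.QuantumFields.BalabanUV.Beta.MultiscaleDecayBudget
open Summit.QuantumFields.BalabanUV.Beta.MultiscaleDecay (hc_levelOp decay_levelOp)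
open Literature.MathematicalPhysics.QuantumFieldTheory.Balaban1983to89
open Literature.MathematicalPhysics.QuantumFieldTheory.Balaban1983to89.B9Thm37Glue (covD covDT)
open Literature.MathematicalPhysics.QuantumFieldTheory.Balaban1983to89.B9Thm37GluePU (bsrc btgt)
open Literature.MathematicalPhysics.QuantumFieldTheory.Balaban1983to89.B9Thm37GlueTorusCov (tblk)
open Literature.MathematicalPhysics.QuantumFieldTheory.Balaban1983to89.B9Thm37GlueTorusCovComp (gMean gMeanT gMean_apply gMeanT_apply)
open Literature.MathematicalPhysics.QuantumFieldTheory.Balaban1983to89.B9Thm37GlueTorusCovLevels (levelOp levelSum levelSum_apply)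
open B5TorusCover (UT Ctr ctrU)

noncomputable section

/-! ## §1 The pointwise averaging budget -/

/-- **Isometry of the transports on squares**: `Σ_k T_{ki}T_{ki′} = δ_{ii′}` ⟹ `Σ_k (Σ_j T_{kj} v_j)² = Σ_j v_j²`. [folklore] -/
theorem isometry_sq_sum {Cp : Type} [Fintype Cp] [DecidableEq Cp] (Tm : Cp → Cp → ℝ)
    (hTm : ∀ i i', ∑ k, Tm k i * Tm k i' = if i = i' then (1 : ℝ) else 0) (v : Cp → ℝ) :
    ∑ k, (∑ j, Tm k j * v j) ^ 2 = ∑ j, v j ^ 2 := by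
  calc ∑ k, (∑ j, Tm k j * v j) ^ 2 = ∑ k, ∑ j, ∑ j', Tm k j * v j * (Tm k j' * v j') := by
        refine Finset.sum_congr rfl fun k _ => ?_
        rw [sq, Finset.sum_mul_sum]
    _ = ∑ j, ∑ j', v j * v j' * ∑ k, Tm k j * Tm k j' := by
        rw [Finset.sum_comm]
        refine Finset.sum_congr rfl fun j _ => ?_
        rw [Finset.sum_comm]
        refine Finset.sum_congr rfl fun j' _ => ?_
        rw [Finset.mul_sum]
        exact Finset.sum_congr rfl fun k _ => by ring
    _ = ∑ j, v j ^ 2 := by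
        refine Finset.sum_congr rfl fun j _ => ?_
        rw [Finset.sum_eq_single j]
        · rw [hTm j j, if_pos rfl]; ring
        · intro j' _ hj'
          rw [hTm j j', if_neg (Ne.symm hj')]; ring
        · intro h; exact absurd (mem_univ j) h

/-- **Cauchy–Schwarz against a unit column**: `Σ_k T_{ki}² = 1` ⟹ `|Σ_k T_{ki} g_k| ≤ √(Σ_k g_k²)`. [folklore] -/
theorem abs_sum_col_mul_le {Cp : Type} [Fintype Cp] [DecidableEq Cp] (Tm : Cp → Cp → ℝ)
    (hTm : ∀ i i', ∑ k, Tm k i * Tm k i' = if i = i' then (1 : ℝ) else 0) (i : Cp) (g : Cp → ℝ) :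
    |∑ k, Tm k i * g k| ≤ Real.sqrt (∑ k, g k ^ 2) := by
  have hcol : ∑ k, Tm k i ^ 2 = 1 := by
    have := hTm i i
    rw [if_pos rfl] at this
    simpa only [sq] using this
  have hcs := Finset.sum_mul_sq_le_sq_mul_sq (Finset.univ) (fun k => Tm k i) g
  -- `(Σ T g)² ≤ (Σ T²)(Σ g²) = Σ g²`
  rw [hcol, one_mul] at hcs
  calc |∑ k, Tm k i * g k| = Real.sqrt ((∑ k, Tm k i * g k) ^ 2) := (Real.sqrt_sq_eq_abs _).symm
    _ ≤ Real.sqrt (∑ k, g k ^ 2) := Real.sqrt_le_sqrt hcs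

/-- **Cauchy–Schwarz for a plain finite sum**: `(Σ_{x∈F} h x)² ≤ #F · Σ_{x∈F} (h x)²`. [folklore] -/
theorem sq_sum_le_card_mul {α : Type} (F : Finset α) (h : α → ℝ) :
    (∑ x ∈ F, h x) ^ 2 ≤ F.card * ∑ x ∈ F, h x ^ 2 := by
  have hcs := Finset.sum_mul_sq_le_sq_mul_sq F (fun _ => (1 : ℝ)) h
  simpa only [one_mul, one_pow, Finset.sum_const, nsmul_eq_mul, mul_one] using hcs

variable {d : ℕ} {N : Fin d → ℕ} [∀ i, NeZero (N i)] [NeZero d] {Cp J K : Type} [Fintype Cp] [DecidableEq Cp] [Nonempty Cp]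
  [Fintype J] [Fintype K] [DecidableEq K] (S : J → ℕ) (hS : ∀ l, 1 ≤ S l) (hdivS : ∀ l i, S l ∣ N i) (lvl : K → J)
  (zc : (k : K) → Ctr N (S (lvl k)))

omit [NeZero d] [Fintype Cp] [DecidableEq Cp] [Nonempty Cp] [Fintype J] [Fintype K] in
/-- **The level-`l_k` block with corner `ctrU (zc k)` IS cell `k`** (as site sets). [folklore] -/
theorem block_filter_eq_cell (hdisj : ∀ k k' v v', cellPt S hS hdivS lvl zc k v = cellPt S hS hdivS lvl zc k' v' → k = k')
    (hcover : ∀ x : UT N, ∃ k, ∃ v : Box d (S (lvl k)), cellPt S hS hdivS lvl zc k v = x) (k : K) :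
    (univ.filter fun x : UT N => ctrU N (S (lvl k)) (tblk (hS (lvl k)) (hdivS (lvl k)) x) = ctrU N (S (lvl k)) (zc k)) =
      univ.filter (fun x : UT N => cellOf S hS hdivS lvl zc hcover x = k) := by
  classical
  ext x
  simp only [mem_filter, mem_univ, true_and]
  constructor
  · intro hx
    have hz : tblk (hS (lvl k)) (hdivS (lvl k)) x = zc k := ctrU_injective (hS (lvl k)) hx
    obtain ⟨v, hv⟩ := (tblk_eq_iff (hS (lvl k)) (hdivS (lvl k)) x (zc k)).mp hz
    rw [← hv]
    exact cellOf_cellPt S hS hdivS lvl zc hdisj hcover k v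
  · intro hx
    obtain ⟨v, hv⟩ := cellOf_spec S hS hdivS lvl zc hcover x
    subst hx
    have h := tblk_cubePt (hS (lvl (cellOf S hS hdivS lvl zc hcover x))) (hdivS (lvl (cellOf S hS hdivS lvl zc hcover x)))
      (zc (cellOf S hS hdivS lvl zc hcover x)) v
    have hv' : cubePt (hS (lvl (cellOf S hS hdivS lvl zc hcover x))) (hdivS (lvl (cellOf S hS hdivS lvl zc hcover x)))
        (zc (cellOf S hS hdivS lvl zc hcover x)) v = x := hv
    rw [hv'] at h
    rw [h]

omit [NeZero d] [DecidableEq Cp] [Nonempty Cp] [Fintype J] [Fintype K] in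
/-- The cell × component sum splits: `Σ_{q ∈ cell k × Cp} F q = Σ_{x ∈ cell k} Σ_j F(x,j)`. [folklore] -/
theorem sum_cellCp_eq (hcover : ∀ x : UT N, ∃ k, ∃ v : Box d (S (lvl k)), cellPt S hS hdivS lvl zc k v = x) (k : K)
    (F : UT N × Cp → ℝ) :
    ∑ q ∈ univ.filter (fun q : UT N × Cp => cellOf S hS hdivS lvl zc hcover q.1 = k), F q =
      ∑ x ∈ univ.filter (fun x : UT N => cellOf S hS hdivS lvl zc hcover x = k), ∑ j, F (x, j) := by
  classical
  have heq : (univ.filter (fun q : UT N × Cp => cellOf S hS hdivS lvl zc hcover q.1 = k)) =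
      (univ.filter (fun x : UT N => cellOf S hS hdivS lvl zc hcover x = k)) ×ˢ (univ : Finset Cp) := by
    ext q
    simp only [mem_filter, mem_univ, true_and, mem_product, and_true]
  rw [heq, Finset.sum_product]

omit [NeZero d] [Nonempty Cp] [Fintype K] in
/-- **THE POINTWISE AVERAGING BUDGET.**  In the MODEL setting (disjoint covering cube family, block weights `W_l(x) = ω_l(corner_l x)`
supported on the level-`l` cells (`hsupp`), isometric transports `T`, coefficients `a ≥ 0`, print size `a_lω_l²S_l^d ≤ a_max/S_l²`):
for every field `f` and `p = (x, i)` with `x` in cell `k`,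
`|((Σ_l a_lG_lᵀG_l) f)(p)| ≤ a_max·(S_{l_k}²)⁻¹·√((S_{l_k}^d)⁻¹·Σ_{q ∈ cell k × Cp} f(q)²)` — only the level `l_k` acts at `x`; the
transported cell mean costs `√#cell·‖f‖_{ℓ²(cell)}` and carries the weight `aω²`.  (The MODEL form of «(Q′*aQ′λ)(x) =
a_j(L^jη)^{−2}(Q′_jλ)(y), x ∈ B^j(y)».) [cite: Balaban1985BackgroundPropagators, (3.16) p.393 + (3.24) p.394] [folklore] -/
theorem abs_levelSum_apply_le
    (hdisj : ∀ k k' v v', cellPt S hS hdivS lvl zc k v = cellPt S hS hdivS lvl zc k' v' → k = k')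
    (hcover : ∀ x : UT N, ∃ k, ∃ v : Box d (S (lvl k)), cellPt S hS hdivS lvl zc k v = x)
    (T : J → UT N → Cp → Cp → ℝ) (hT : ∀ l x i i', ∑ k, T l x k i * T l x k i' = if i = i' then (1 : ℝ) else 0)
    (a : J → ℝ) (ha : ∀ j, 0 ≤ a j) (ω : J → UT N → ℝ)
    (hsupp : ∀ l x, ω l (ctrU N (S l) (tblk (hS l) (hdivS l) x)) ≠ 0 → ∃ k v, lvl k = l ∧ cellPt S hS hdivS lvl zc k v = x)
    {amax : ℝ} (hamax : 0 ≤ amax)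
    (hscale : ∀ k, a (lvl k) * ω (lvl k) (ctrU N (S (lvl k)) (zc k)) ^ 2 * (S (lvl k) : ℝ) ^ d ≤ amax / (S (lvl k) : ℝ) ^ 2)
    (f : UT N × Cp → ℝ) (p : UT N × Cp) (k : K) (hpk : cellOf S hS hdivS lvl zc hcover p.1 = k) :
    |levelSum (fun l x => ctrU N (S l) (tblk (hS l) (hdivS l) x)) (fun l x => ω l (ctrU N (S l) (tblk (hS l) (hdivS l) x))) T a
        f p| ≤
      amax * ((S (lvl k) : ℝ) ^ 2)⁻¹ *
        Real.sqrt (((S (lvl k) : ℝ) ^ d)⁻¹ * ∑ q ∈ univ.filter (fun q : UT N × Cp => cellOf S hS hdivS lvl zc hcover q.1 = k), f q ^ 2) := by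
  classical
  set x := p.1 with hx
  set i := p.2 with hi
  set lk := lvl k with hlk
  set β : UT N := ctrU N (S lk) (zc k) with hβ
  have hSpos : (0 : ℝ) < (S lk : ℝ) := by exact_mod_cast hS lk
  -- `x` lies in cell `k`, so its level-`l_k` block is `zc k`
  have hxz : tblk (hS lk) (hdivS lk) x = zc k := by
    have hmem : x ∈ univ.filter (fun x' : UT N => cellOf S hS hdivS lvl zc hcover x' = k) :=
      mem_filter.mpr ⟨mem_univ _, hpk⟩
    rw [← block_filter_eq_cell S hS hdivS lvl zc hdisj hcover k] at hmem
    exact ctrU_injective (hS lk) (mem_filter.mp hmem).2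
  -- only the level `l_k` acts at `x`
  have hzero : ∀ l, l ≠ lk → ω l (ctrU N (S l) (tblk (hS l) (hdivS l) x)) = 0 := by
    intro l hl
    by_contra hne
    obtain ⟨k₁, v₁, hk₁, hx₁⟩ := hsupp l x hne
    have : cellOf S hS hdivS lvl zc hcover x = k₁ := by
      rw [← hx₁]; exact cellOf_cellPt S hS hdivS lvl zc hdisj hcover k₁ v₁
    rw [hpk] at this
    subst this
    exact hl hk₁.symm
  have happ : levelSum (fun l x => ctrU N (S l) (tblk (hS l) (hdivS l) x))
      (fun l x => ω l (ctrU N (S l) (tblk (hS l) (hdivS l) x))) T a f p =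
      a lk * (ω lk β * ∑ i', T lk x i' i *
        gMean (fun x => ctrU N (S lk) (tblk (hS lk) (hdivS lk) x))
          (fun x => ω lk (ctrU N (S lk) (tblk (hS lk) (hdivS lk) x))) (T lk) f (β, i')) := by
    rw [levelSum_apply, Finset.sum_eq_single lk]
    · rw [gMeanT_apply, hxz]
    · intro l _ hl
      rw [gMeanT_apply, hzero l hl, zero_mul, mul_zero]
    · intro h; exact absurd (mem_univ lk) h
  -- the block mean over the cell
  set F := univ.filter (fun x' : UT N => ctrU N (S lk) (tblk (hS lk) (hdivS lk) x') = β) with hF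
  have hFcell : F = univ.filter (fun x' : UT N => cellOf S hS hdivS lvl zc hcover x' = k) :=
    block_filter_eq_cell S hS hdivS lvl zc hdisj hcover k
  set g : Cp → ℝ := fun i' => ∑ x' ∈ F, ∑ j, T lk x' i' j * f (x', j) with hg
  have hmean : ∀ i', gMean (fun x => ctrU N (S lk) (tblk (hS lk) (hdivS lk) x))
      (fun x => ω lk (ctrU N (S lk) (tblk (hS lk) (hdivS lk) x))) (T lk) f (β, i') = ω lk β * g i' := by
    intro i'
    rw [gMean_apply, hg]
    simp only
    rw [Finset.mul_sum, hF, Finset.sum_filter]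
    refine Finset.sum_congr rfl fun x' _ => ?_
    split_ifs with h
    · rw [h]
    · rfl
  -- Cauchy–Schwarz twice
  have hCS1 : |∑ i', T lk x i' i * (ω lk β * g i')| ≤ |ω lk β| * Real.sqrt (∑ i', g i' ^ 2) := by
    have h1 : ∑ i', T lk x i' i * (ω lk β * g i') = ω lk β * ∑ i', T lk x i' i * g i' := by
      rw [Finset.mul_sum]; exact Finset.sum_congr rfl fun i' _ => by ring
    rw [h1, abs_mul]
    exact mul_le_mul_of_nonneg_left (abs_sum_col_mul_le (T lk x) (hT lk x) i g) (abs_nonneg _)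
  have hCS2 : ∑ i', g i' ^ 2 ≤ F.card * ∑ x' ∈ F, ∑ j, f (x', j) ^ 2 := by
    calc ∑ i', g i' ^ 2 ≤ ∑ i', (F.card * ∑ x' ∈ F, (∑ j, T lk x' i' j * f (x', j)) ^ 2) :=
          Finset.sum_le_sum fun i' _ => sq_sum_le_card_mul F _
      _ = F.card * ∑ x' ∈ F, ∑ i', (∑ j, T lk x' i' j * f (x', j)) ^ 2 := by
          rw [← Finset.mul_sum, Finset.sum_comm]
      _ = F.card * ∑ x' ∈ F, ∑ j, f (x', j) ^ 2 := by
          congr 1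
          exact Finset.sum_congr rfl fun x' _ => isometry_sq_sum (T lk x') (hT lk x') (fun j => f (x', j))
  have hcard : (F.card : ℝ) ≤ (S lk : ℝ) ^ d := by
    have := card_block_le (hS lk) (hdivS lk) β
    rw [← hF] at this
    exact_mod_cast this
  -- the cell × component sum
  have hsumF : ∑ x' ∈ F, ∑ j, f (x', j) ^ 2 = ∑ q ∈ univ.filter (fun q : UT N × Cp => cellOf S hS hdivS lvl zc hcover q.1 = k), f q ^ 2 := by
    rw [hFcell, sum_cellCp_eq S hS hdivS lvl zc hcover k (fun q => f q ^ 2)]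
  set Sc := ∑ q ∈ univ.filter (fun q : UT N × Cp => cellOf S hS hdivS lvl zc hcover q.1 = k), f q ^ 2 with hSc
  have hSc0 : 0 ≤ Sc := Finset.sum_nonneg fun q _ => sq_nonneg _
  have hsqrt : Real.sqrt (∑ i', g i' ^ 2) ≤ Real.sqrt ((S lk : ℝ) ^ d) * Real.sqrt Sc := by
    rw [← Real.sqrt_mul (pow_nonneg hSpos.le d)]
    refine Real.sqrt_le_sqrt (hCS2.trans ?_)
    rw [hsumF]
    exact mul_le_mul_of_nonneg_right hcard hSc0
  -- the print-size weight
  have hw : a lk * ω lk β ^ 2 ≤ amax / (S lk : ℝ) ^ 2 / (S lk : ℝ) ^ d := by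
    rw [le_div_iff₀ (pow_pos hSpos d)]
    exact hscale k
  have haω : 0 ≤ a lk * ω lk β ^ 2 := mul_nonneg (ha lk) (sq_nonneg _)
  -- assemble
  have hsum_eq : ∑ i', T lk x i' i *
      gMean (fun x => ctrU N (S lk) (tblk (hS lk) (hdivS lk) x))
        (fun x => ω lk (ctrU N (S lk) (tblk (hS lk) (hdivS lk) x))) (T lk) f (β, i') =
      ∑ i', T lk x i' i * (ω lk β * g i') := Finset.sum_congr rfl fun i' _ => by rw [hmean i']
  rw [happ, hsum_eq]
  calc |a lk * (ω lk β * ∑ i', T lk x i' i * (ω lk β * g i'))|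
      = a lk * |ω lk β| * |∑ i', T lk x i' i * (ω lk β * g i')| := by
        rw [abs_mul, abs_mul, abs_of_nonneg (ha lk), mul_assoc]
    _ ≤ a lk * |ω lk β| * (|ω lk β| * Real.sqrt (∑ i', g i' ^ 2)) :=
        mul_le_mul_of_nonneg_left hCS1 (mul_nonneg (ha lk) (abs_nonneg _))
    _ = a lk * ω lk β ^ 2 * Real.sqrt (∑ i', g i' ^ 2) := by rw [← sq_abs]; ring
    _ ≤ amax / (S lk : ℝ) ^ 2 / (S lk : ℝ) ^ d * (Real.sqrt ((S lk : ℝ) ^ d) * Real.sqrt Sc) :=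
        mul_le_mul hw hsqrt (Real.sqrt_nonneg _) (div_nonneg (div_nonneg hamax (sq_nonneg _)) (pow_nonneg hSpos.le d))
    _ = amax * ((S lk : ℝ) ^ 2)⁻¹ * Real.sqrt (((S lk : ℝ) ^ d)⁻¹ * Sc) := by
        have hSd : (0 : ℝ) < (S lk : ℝ) ^ d := pow_pos hSpos d
        set r := Real.sqrt ((S lk : ℝ) ^ d) with hr
        have hr0 : 0 < r := Real.sqrt_pos.mpr hSd
        have hsq : (S lk : ℝ) ^ d = r * r := (Real.mul_self_sqrt hSd.le).symm
        rw [Real.sqrt_mul (inv_nonneg.mpr hSd.le), Real.sqrt_inv, ← hr, hsq]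
        calc amax / (S lk : ℝ) ^ 2 / (r * r) * (r * Real.sqrt Sc)
            = amax * ((S lk : ℝ) ^ 2)⁻¹ * (r⁻¹ * Real.sqrt Sc) * (r * r⁻¹) := by ring
          _ = amax * ((S lk : ℝ) ^ 2)⁻¹ * (r⁻¹ * Real.sqrt Sc) := by rw [mul_inv_cancel₀ hr0.ne', mul_one]

end

end Summit.QuantumFields.BalabanUV.Beta.MultiscaleAveragingPointwise
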